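import Summits.BirchSwinnertonDyer.BirchSwinnertonDyer.Theorems.ClassRecordThreeCornerAtThreeKolyvagin
import Summits.BirchSwinnertonDyer.BirchSwinnertonDyer.Theorems.ClassRecordThreeCornerAtThreeUpperCoChainByName
import HarnessLib

/-!
# Route `ClassRecordThree` (rung K2@3), crux 7 `CornerAtThree` (item stmt-BirchSwinnertonDyer-19111, shared with
# `KolyvaginRoadThree`), stub `stub_cornerUpper3` — the HYBRID reading by CARRIER PROFILE: lane A's classical
# Jetchev-MAX object on MONO-carrier corner curves, lane B's co-chain object (the Kolyvagin-system «⊇» half at 𝟙)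
# on MULTI-carrier corner curves (cell `bsd-stepL`, width-lever second lane `bsd-stepL-corner3-p2` g2;
# `--supports stmt-BirchSwinnertonDyer-19111`)

HONEST FRAMING: theorems only (no definition, no named fact, no `sorry`); every statement is CONDITIONAL on the
cited Literature facts it lists BY NAME and on hypothesis-SHAPED open inputs (nothing asserted about any curve);
item 19111 stays open; no stub is discharged; BSD is not advanced; no census word, tier or label moves (T7).

## The point

The population of conjunct 3 `Three.CornerUpperAt W` (the Tamagawa-SHARP Kolyvagin bound
`ord₃ #Ш(E/K) + 2·ord₃ ∏_ℓ c_ℓ(E) ≤ 2·ord₃ [E(K):ℤP]` on the ¬Surj corner at `3` with `3 ∣ ∏c`) splits by the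
CARRIER PROFILE of the curve — an invariant of `W`, not of the frame:

* MONO-carrier: `∃ v, ord₃ ∏_ℓ c_ℓ(E) ≤ ord₃ c_v(E)` (ONE place carries the whole `3`-part of `∏c`). There the
  Jetchev MAX form of the global divisibility of derived Heegner points (`P_n ∈ 3^s E(K_n)` for `s ≤ ord₃ c_v`,
  lane A's object `stub_upper3_jetchevMax` of `HOME/corner/g7/bc3/CornerAtThreeUpper_birth.lean`, the corner twin of
  tam3's registered `stub_jetchevMaxHLAtThree`; shape of Jetchev 2008 Thm. 1.4, a CLASSICAL Kolyvagin-system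
  statement whose depth `max_v ord₃ c_v` is exactly the ceiling of every Selmer-structure ∕ Kolyvagin-system-MODULE
  argument — cf. the tree's `KimAtThreeD7uTamagawaSharp` §7 and lane A's CORNER-G7 §1 «the lozenge step sees only
  max») IS the full depth `ord₃ ∏c`, so Kolyvagin's structure theorem under irreducibility (Cha 2005 Rmk. 25 ∕
  Matar–Nekovář 2019, lane A's `Koly.shaIndexBound_sharp_of_globalDivisibility_of_irreducible`) gives the conjunct:
  `Koly.cornerUpperAt_of_jetchevMaxAt_of_monoCarrier`.
* MULTI-carrier: `∀ v, ord₃ c_v(E) < ord₃ ∏_ℓ c_ℓ(E)`. There the SUM over carriers is beyond every classical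
  Kolyvagin-system argument (BCGS arXiv:2312.09301 Thm. 2 obtains it from the anticyclotomic main conjecture); the
  co-chain's typed input `Three.CornerCoStepLAt W` — the Kolyvagin-system («⊇») half of the anticyclotomic BDP main
  conjecture at `𝟙` on the corner frames, where the anticyclotomic CONTROL identity supplies the Tamagawa term
  `∏_{w ∣ N⁺} c_w = (∏_ℓ c_ℓ)²` EXACTLY (g0's p527420 ∕ p528380) — gives the conjunct
  (`cornerUpperAt_of_cornerCoStepLAt_of_facts`, p532389), and is EQUIVALENT to it modulo cited facts (p529295).

Hence (`cornerAtThreeUpper_of_jetchevMaxMono_of_coStepLMulti_of_facts`): the registered stub's constant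
`Theorems.CornerAtThreeUpper` ⟸ { J₃-MAX on MONO-carrier corner curves [classical, lane A's road],
`Three.CornerCoStepLAt` on MULTI-carrier corner curves [IMC-grade, lane B's road] } + cited facts; and the same two
objects give lane B's registered open stub `Theorems.CornerAtThreeCoStepL` itself
(`cornerAtThreeCoStepL_of_jetchevMaxMono_of_coStepLMulti_of_facts`, through g0's converse with Matar–Nekovář), i.e.
**the open object of the co-chain line SHRINKS to the multi-carrier corner curves**, and lane A's IMC-grade stub
`stub_upper3_jetchevMulti` (full-depth point divisibility) is replaced on the same population by a statement that is
TIGHT (⟺ the conjunct). Census (x11b3 CORNER-CENSUS `corner3_census.tsv`, N < 5·10⁵, two engines; evidence, never a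
fact): of the 208 corner pairs with `3 ∣ ∏c`, **138 are mono-carrier and 70 multi-carrier** (3Ns 62 ∕ 3Nn 8;
carrier-exponent profiles (1,1) ×54, (1,2) ×6, (1,1,1) ×7, (1,2,2) ×2, (1,1,2) ×1); every carrier is a SPLIT
multiplicative prime (`3` itself on the 129 split-corner pairs, `c₃ = v₃(Δ) ≡ 0 mod 3`; no additive carrier: the
image is a `2`-group, so Kodaira types IV ∕ IV* do not occur). At `p = 5` the same cut was 37 ∕ 3 (CORNER-G7 §1).

References: [Jetchev2008] Thm. 1.4, Cor. 1.5, §6; [Cha2005] Thm. 21, Rmk. 25; [MatarNekovar2019] Thm. 0.3, 0.7,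
§0.11; [Castella2018] Thm. 2.3, Thm. 3.2, §5; [JetchevSkinnerWan2017] §7.4.2; Burungale–Castella–Grossi–Skinner
arXiv:2312.09301 Thm. 2 (shape); K. Büyükboduk, JNT 129 (2009) §4.2 Question 1; tree: lane A
`Theorems/ClassRecordThreeCornerAtThreeKolyvagin.lean` (p425172), lane B `…UpperCoChainByName.lean` (p532389),
`…CoChainDefs.lean` (p530129), `KimAtThreeD7uTamagawaSharp.lean`.
-/

noncomputable section

open scoped Classical

namespace Summit.BirchSwinnertonDyer.Rank1Residual.X11b.Three

open scoped NumberField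

open WeierstrassCurve IsDedekindDomain Literature.NumberTheory.EllipticCurves
  Literature.NumberTheory.EllipticCurves.ModularForms
  Literature.NumberTheory.EllipticCurves.Rank1Residual
  Literature.NumberTheory.EllipticCurves.Rank1Residual.Typed
  Literature.NumberTheory.GaloisRepresentations Literature.NumberTheory.GaloisCohomology
  Summit.BirchSwinnertonDyer.Rank1Residual Summit.BirchSwinnertonDyer.Rank1Residual.X11b

/-! ### §1 One curve: conjunct 3 from the Jetchev direction AT THAT CURVE (lane A's cut, per `W`) -/

namespace Koly

/-- **`Three.CornerUpperAt W` from the Jetchev direction at `W` (full depth) + Kolyvagin's structure theorem under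
irreducibility** — lane A's `cornerUpperAt_of_jetchevDivisibility_of_irreducible` with its class-wide input J₃ᶜ
replaced by the SAME hypothesis shape AT THE ONE CURVE `W` (`hJW`: on every Manin-good conductor-`N_E` frame
`(Dt, β, ι)` of the corner pair over an odd imaginary quadratic Heegner field, every derived Heegner point `P_n`
at Kolyvagin levels of index `≥ s` is `3^s`-divisible in `E(K_n)` for all `s ≤ ord₃ ∏_ℓ c_ℓ(E)`). PUBLISHED
binders as there: Kolyvagin (`hKo`), Shimura reciprocity at conductor `1` (`hrec`), Darmon 2004 Thm. 3.6 (`hD36`),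
and the cited structure fact `hChaU` (flag `Cha05-Rmk25-structure`). Proof verbatim as lane A's (Darmon's
conductor-`1` datum, `P_1 = y_K = P`, rank one, no `3`-torsion, then `shaIndexBound_sharp_of_globalDivisibility_of_irreducible`).
CONDITIONAL on `hJW` and `hChaU`; nothing booked.
[cite: Cha2005, Thm. 21 and Rmk. 25 (pp. 173–175)] [cite: MatarNekovar2019, Thm. 0.7, §0.9, §0.11 (pp. 456–457)]
[cite: Jetchev2008, Thm. 1.4 and Conj. 1.3 (p. 812) (shape)] [cite: Darmon2004, Thm. 3.6 (PDF p. 43)] -/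
theorem cornerUpperAt_of_jetchevDivisibilityAt_of_irreducible
    (hKo : ∀ (N : ℕ) [NeZero N] (W : WeierstrassCurve ℚ) (K : Type) [Field K] [NumberField K],
      kolyvagin N W K)
    (hrec : ∀ (N : ℕ) [NeZero N] (W : WeierstrassCurve ℚ) (K : Type) [Field K] [NumberField K],
      heegnerPointOfConductor_one_galoisConj N W K)
    (hD36 : ∀ (N : ℕ) [NeZero N] (W : WeierstrassCurve ℚ) (K : Type) [Field K] [NumberField K],
      phi_heegnerTau_mem_singularModuliField N W K)
    (hChaU : Cha2005.rmk25_padicValNat_card_sha_primary_add_le_of_globalDivisibility)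
    (W : WeierstrassCurve ℚ) [W.IsElliptic] [W.IsGloballyMinimal]
    (hJW : ∀ [NeZero (W.conductorNorm ℤ)] (K : Type) [Field K] [NumberField K]
      (Dt : ModularParametrizationData W (W.conductorNorm ℤ)) (β : ℤ) (ι : K →+* ℂ),
      ClassX11b W 3 → ¬ Surj W 3 →
      IsImaginaryQuadratic K → SatisfiesHeegnerHypothesis (W.conductorNorm ℤ) K →
      Odd (NumberField.discr K) →
      (4 * (W.conductorNorm ℤ : ℤ)) ∣ β ^ 2 - NumberField.discr K → ¬ (3 : ℤ) ∣ Dt.c →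
      ∀ (s : ℕ), s ≤ padicValNat 3 W.tamagawaProduct →
        ∀ (n : ℕ) (d : KolyvaginHeegnerData Dt β ι n), Squarefree n →
          (∀ ℓ ∈ n.primeFactors, Zhang2014.IsKolyvaginPrime (W.conductorNorm ℤ) W K 3 ℓ ∧
            s ≤ Zhang2014.kolyvaginIndex W 3 ℓ) → PDiv d 3 s) :
    CornerUpperAt W := by
  haveI : Fact (Nat.Prime 3) := ⟨Nat.prime_three⟩
  intro N _ K _ _ Dt H ι P hX hns _ht hN hK hodd hHN _hLt hP hc hPinf hfin
  subst hN
  obtain ⟨_, _, hmult, hirr⟩ := id hX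
  haveI : Finite (W.baseChange K).sha := hfin
  -- `d_K ≠ −3` (`3 ∣ N_E` splits in `K`) and `d_K ≠ −4` (`d_K` odd)
  have h3N : 3 ∣ W.conductorNorm ℤ := dvd_conductorNorm_of_classX11b hX
  have hpd : ¬ ((3 : ℕ) : ℤ) ∣ NumberField.discr K :=
    not_dvd_discr_of_satisfiesHeegnerHypothesis hK hHN Nat.prime_three h3N
  have h3 : NumberField.discr K ≠ -3 := by
    intro h; apply hpd; rw [h]; exact ⟨-1, by norm_num⟩
  have h4 : NumberField.discr K ≠ -4 := by
    intro h; have := Int.odd_iff.mp hodd; omega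
  -- a conductor-1 Kolyvagin–Heegner datum on the frame (Dt, H.β, ι) (Darmon 2004, Thm. 3.6)
  obtain ⟨d₁⟩ := exists_kolyvaginHeegnerData_one (hD36 _ W K) hK Dt H.β ι H.dvd_sq_sub
  -- the bottom point: P(1) = y_K = P in E(K̄) (Shimura reciprocity at conductor 1)
  have hPd : d₁.toGeomPoints d₁.derivedPoint = toGeomPoints (W.baseChange K) P :=
    KolyvaginBottom.toGeomPoints_derivedPoint_one_eq (hrec _ W K) hK hHN hP d₁ rfl
  -- rank one (Kolyvagin) and no 3-torsion (E[3] irreducible, K imaginary quadratic)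
  obtain ⟨hrank, -⟩ := hKo (W.conductorNorm ℤ) W K hK hHN ⟨Dt, H, ι, hP⟩ hPinf
  have hbot := torsionBy_eq_bot_of_isImaginaryQuadratic_of_hasIrreducibleModPGaloisRep W K hK
    Nat.prime_three hirr
  have hiv : ∀ x : (W.baseChange K).toAffine.Point, 3 • x = 0 → x = 0 := fun x hx ↦ by
    have hmem : x ∈ AddSubgroup.torsionBy (W.baseChange K).toAffine.Point ((3 : ℕ) : ℤ) := by
      rw [mem_torsionBy_iff, natCast_zsmul]
      exact hx
    rw [hbot] at hmem
    exact hmem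
  exact shaIndexBound_sharp_of_globalDivisibility_of_irreducible hChaU W K 3 (by norm_num) hmult hirr hK
    h3 h4 hHN Dt H.β ι d₁ P hPd hPinf hrank hiv (hJW K Dt H.β ι hX hns hK hHN hodd H.dvd_sq_sub hc)

/-- **MONO-carrier corner curves: `Three.CornerUpperAt W` from the Jetchev MAX form AT `W`.** If ONE place `v`
carries the whole `3`-part of the Tamagawa product (`hmono : ∃ v, ord₃ ∏_ℓ c_ℓ(E) ≤ ord₃ c_v(E)`), the MAX-form
divisibility at `W` (`hmaxW`: for every carrier `v` and every `s ≤ ord₃ c_v(E)`, `P_n ∈ 3^s E(K_n)` at Kolyvagin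
levels of index `≥ s` — lane A's `stub_upper3_jetchevMax` read at the one curve; Jetchev 2008 Thm. 1.4 shape `m_∞ ≥
m_max`) is the full-depth divisibility, and `cornerUpperAt_of_jetchevDivisibilityAt_of_irreducible` applies.
CONDITIONAL on `hmaxW`, `hmono` and `hChaU`; nothing booked. [cite: Jetchev2008, Thm. 1.4 and Cor. 1.5 (shape; printed for p ∤ N, ρ̄ onto)]
[cite: Cha2005, Rmk. 25 (p. 175)] -/
theorem cornerUpperAt_of_jetchevMaxAt_of_monoCarrier
    (hKo : ∀ (N : ℕ) [NeZero N] (W : WeierstrassCurve ℚ) (K : Type) [Field K] [NumberField K],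
      kolyvagin N W K)
    (hrec : ∀ (N : ℕ) [NeZero N] (W : WeierstrassCurve ℚ) (K : Type) [Field K] [NumberField K],
      heegnerPointOfConductor_one_galoisConj N W K)
    (hD36 : ∀ (N : ℕ) [NeZero N] (W : WeierstrassCurve ℚ) (K : Type) [Field K] [NumberField K],
      phi_heegnerTau_mem_singularModuliField N W K)
    (hChaU : Cha2005.rmk25_padicValNat_card_sha_primary_add_le_of_globalDivisibility)
    (W : WeierstrassCurve ℚ) [W.IsElliptic] [W.IsGloballyMinimal]
    (hmono : ∃ v : HeightOneSpectrum (𝓞 ℚ),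
      padicValNat 3 W.tamagawaProduct ≤ padicValNat 3 (W.tamagawaNumberAt v))
    (hmaxW : ∀ [NeZero (W.conductorNorm ℤ)] (K : Type) [Field K] [NumberField K]
      (Dt : ModularParametrizationData W (W.conductorNorm ℤ)) (β : ℤ) (ι : K →+* ℂ),
      ClassX11b W 3 → ¬ Surj W 3 →
      IsImaginaryQuadratic K → SatisfiesHeegnerHypothesis (W.conductorNorm ℤ) K →
      Odd (NumberField.discr K) →
      (4 * (W.conductorNorm ℤ : ℤ)) ∣ β ^ 2 - NumberField.discr K → ¬ (3 : ℤ) ∣ Dt.c →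
      ∀ (v : HeightOneSpectrum (𝓞 ℚ)) (s : ℕ), s ≤ padicValNat 3 (W.tamagawaNumberAt v) →
        ∀ (n : ℕ) (d : KolyvaginHeegnerData Dt β ι n), Squarefree n →
          (∀ ℓ ∈ n.primeFactors, Zhang2014.IsKolyvaginPrime (W.conductorNorm ℤ) W K 3 ℓ ∧
            s ≤ Zhang2014.kolyvaginIndex W 3 ℓ) → PDiv d 3 s) :
    CornerUpperAt W := by
  refine cornerUpperAt_of_jetchevDivisibilityAt_of_irreducible hKo hrec hD36 hChaU W ?_
  intro _ K _ _ Dt β ι hX hns hK hHN hodd hβ hc s hs n d hn hℓ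
  obtain ⟨v, hv⟩ := hmono
  exact hmaxW K Dt β ι hX hns hK hHN hodd hβ hc v s (hs.trans hv) n d hn hℓ

end Koly

/-- **MONO-carrier corner curves: lane B's open object `Three.CornerCoStepLAt W` (the «⊇» half at `𝟙` on the corner
frames of `W`) from lane A's Jetchev MAX form at `W`**, modulo cited facts — `Koly.cornerUpperAt_of_jetchevMaxAt_of_monoCarrier`
followed by g0's converse `cornerCoStepLAt_of_cornerUpperAt_of_facts` (Gross–Zagier, Kolyvagin, modularity, GZK,
newforms, Poitou–Tate ×2, Matar–Nekovář). CONDITIONAL on `hmaxW`, `hmono` and the eleven cited facts; nothing booked.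
[cite: Jetchev2008, Thm. 1.4 (shape)] [cite: Castella2018, §5 (5.1)–(5.2) (arXiv:1704.06608 p. 12)]
[cite: MatarNekovar2019, Thm. 0.3 (p. 456)] -/
theorem cornerCoStepLAt_of_jetchevMaxAt_of_monoCarrier_of_facts [Fact (Nat.Prime 3)]
    (hGZ : ∀ (N : ℕ) [NeZero N] (W : WeierstrassCurve ℚ) (K : Type) [Field K] [NumberField K],
      gross_zagier N W K)
    (hKo : ∀ (N : ℕ) [NeZero N] (W : WeierstrassCurve ℚ) (K : Type) [Field K] [NumberField K],
      kolyvagin N W K)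
    (hmod : hasEntireLFunction_rat)
    (hGZK : rank_eq_analyticRank_of_analyticRank_le_one) (hnf : exists_isNewformOf)
    (hPT : ∀ (K : Type) [Field K] [NumberField K], poitouTate_selmerStructure_duality K)
    (hPT2 : ∀ (K : Type) [Field K] [NumberField K], poitouTate_sha_tateDual K)
    (hMN : ∀ (N : ℕ) [NeZero N] (W : WeierstrassCurve ℚ) (K : Type) [Field K] [NumberField K],
      MatarNekovar2019.thm03_padicValNat_card_sha_le_of_irreducible N W K)
    (hrec : ∀ (N : ℕ) [NeZero N] (W : WeierstrassCurve ℚ) (K : Type) [Field K] [NumberField K],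
      heegnerPointOfConductor_one_galoisConj N W K)
    (hD36 : ∀ (N : ℕ) [NeZero N] (W : WeierstrassCurve ℚ) (K : Type) [Field K] [NumberField K],
      phi_heegnerTau_mem_singularModuliField N W K)
    (hChaU : Cha2005.rmk25_padicValNat_card_sha_primary_add_le_of_globalDivisibility)
    (W : WeierstrassCurve ℚ) [W.IsElliptic] [W.IsGloballyMinimal]
    (hmono : ∃ v : HeightOneSpectrum (𝓞 ℚ),
      padicValNat 3 W.tamagawaProduct ≤ padicValNat 3 (W.tamagawaNumberAt v))
    (hmaxW : ∀ [NeZero (W.conductorNorm ℤ)] (K : Type) [Field K] [NumberField K]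
      (Dt : ModularParametrizationData W (W.conductorNorm ℤ)) (β : ℤ) (ι : K →+* ℂ),
      ClassX11b W 3 → ¬ Surj W 3 →
      IsImaginaryQuadratic K → SatisfiesHeegnerHypothesis (W.conductorNorm ℤ) K →
      Odd (NumberField.discr K) →
      (4 * (W.conductorNorm ℤ : ℤ)) ∣ β ^ 2 - NumberField.discr K → ¬ (3 : ℤ) ∣ Dt.c →
      ∀ (v : HeightOneSpectrum (𝓞 ℚ)) (s : ℕ), s ≤ padicValNat 3 (W.tamagawaNumberAt v) →
        ∀ (n : ℕ) (d : KolyvaginHeegnerData Dt β ι n), Squarefree n →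
          (∀ ℓ ∈ n.primeFactors, Zhang2014.IsKolyvaginPrime (W.conductorNorm ℤ) W K 3 ℓ ∧
            s ≤ Zhang2014.kolyvaginIndex W 3 ℓ) → Koly.PDiv d 3 s) :
    CornerCoStepLAt W :=
  cornerCoStepLAt_of_cornerUpperAt_of_facts W hGZ hKo hmod hGZK hnf hPT hPT2 hMN
    (Koly.cornerUpperAt_of_jetchevMaxAt_of_monoCarrier hKo hrec hD36 hChaU W hmono hmaxW)

/-! ### §2 Class-wide: the HYBRID reading of `stub_cornerUpper3` and of lane B's open stub -/

/-- **THE HYBRID READING of `stub_cornerUpper3`: `Theorems.CornerAtThreeUpper` (p488767) ⟸ { J₃-MAX on the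
MONO-carrier corner curves (`hmaxMono`, lane A's `stub_upper3_jetchevMax` restricted to `∃ v, ord₃ ∏c ≤ ord₃ c_v`;
classical), `Three.CornerCoStepLAt` on the MULTI-carrier corner curves (`hcoMulti`, lane B's co-chain object
restricted to `∀ v, ord₃ c_v < ord₃ ∏c`; IMC-grade, tight) } + cited facts** (lane A's Kolyvagin ∕ reciprocity ∕
Darmon ∕ Cha–MN structure fact; lane B's GZK ∕ newforms ∕ Poitou–Tate ×2 for the control identity). By cases on the
carrier profile of `W`. Neither input is asserted; both are hypothesis SHAPES; CONDITIONAL; closes nothing.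
[cite: Jetchev2008, Thm. 1.4 (shape)] [cite: Cha2005, Rmk. 25 (p. 175)]
[cite: JetchevSkinnerWan2017, §7.4.2 (eq:shaupper) (arXiv:1512.06894 p. 31)] [cite: Castella2018, Thm. 2.3 (p. 5), Thm. 3.2 (p. 9)] -/
theorem cornerAtThreeUpper_of_jetchevMaxMono_of_coStepLMulti_of_facts [Fact (Nat.Prime 3)]
    (hKo : ∀ (N : ℕ) [NeZero N] (W : WeierstrassCurve ℚ) (K : Type) [Field K] [NumberField K],
      kolyvagin N W K)
    (hrec : ∀ (N : ℕ) [NeZero N] (W : WeierstrassCurve ℚ) (K : Type) [Field K] [NumberField K],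
      heegnerPointOfConductor_one_galoisConj N W K)
    (hD36 : ∀ (N : ℕ) [NeZero N] (W : WeierstrassCurve ℚ) (K : Type) [Field K] [NumberField K],
      phi_heegnerTau_mem_singularModuliField N W K)
    (hChaU : Cha2005.rmk25_padicValNat_card_sha_primary_add_le_of_globalDivisibility)
    (hGZK : rank_eq_analyticRank_of_analyticRank_le_one) (hnf : exists_isNewformOf)
    (hPT : ∀ (K : Type) [Field K] [NumberField K], poitouTate_selmerStructure_duality K)
    (hPT2 : ∀ (K : Type) [Field K] [NumberField K], poitouTate_sha_tateDual K)
    -- OPEN INPUT 1 (classical): Jetchev MAX form on MONO-carrier corner curves (lane A's object, restricted)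
    (hmaxMono : ∀ (W : WeierstrassCurve ℚ) [W.IsElliptic] [W.IsGloballyMinimal] [NeZero (W.conductorNorm ℤ)]
      (K : Type) [Field K] [NumberField K]
      (Dt : ModularParametrizationData W (W.conductorNorm ℤ)) (β : ℤ) (ι : K →+* ℂ),
      (∃ v : HeightOneSpectrum (𝓞 ℚ),
        padicValNat 3 W.tamagawaProduct ≤ padicValNat 3 (W.tamagawaNumberAt v)) →
      ClassX11b W 3 → ¬ Surj W 3 →
      IsImaginaryQuadratic K → SatisfiesHeegnerHypothesis (W.conductorNorm ℤ) K →
      Odd (NumberField.discr K) →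
      (4 * (W.conductorNorm ℤ : ℤ)) ∣ β ^ 2 - NumberField.discr K → ¬ (3 : ℤ) ∣ Dt.c →
      ∀ (v : HeightOneSpectrum (𝓞 ℚ)) (s : ℕ), s ≤ padicValNat 3 (W.tamagawaNumberAt v) →
        ∀ (n : ℕ) (d : KolyvaginHeegnerData Dt β ι n), Squarefree n →
          (∀ ℓ ∈ n.primeFactors, Zhang2014.IsKolyvaginPrime (W.conductorNorm ℤ) W K 3 ℓ ∧
            s ≤ Zhang2014.kolyvaginIndex W 3 ℓ) → Koly.PDiv d 3 s)
    -- OPEN INPUT 2 (IMC-grade, tight): the «⊇» half at 𝟙 on MULTI-carrier corner curves (lane B's object, restricted)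
    (hcoMulti : ∀ (W : WeierstrassCurve ℚ) [W.IsElliptic] [W.IsGloballyMinimal],
      (∀ v : HeightOneSpectrum (𝓞 ℚ),
        padicValNat 3 (W.tamagawaNumberAt v) < padicValNat 3 W.tamagawaProduct) →
      CornerCoStepLAt W) :
    Summit.BirchSwinnertonDyer.BirchSwinnertonDyer.Theorems.CornerAtThreeUpper := by
  intro W _ _
  by_cases hmono : ∃ v : HeightOneSpectrum (𝓞 ℚ),
      padicValNat 3 W.tamagawaProduct ≤ padicValNat 3 (W.tamagawaNumberAt v)
  · exact Koly.cornerUpperAt_of_jetchevMaxAt_of_monoCarrier hKo hrec hD36 hChaU W hmono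
      (fun K _ _ Dt β ι hX hns hK hHN hodd hβ hc v s hs n d hn hℓ ↦
        hmaxMono W K Dt β ι hmono hX hns hK hHN hodd hβ hc v s hs n d hn hℓ)
  · push Not at hmono
    exact cornerUpperAt_of_cornerCoStepLAt_of_facts W hGZK hnf hPT hPT2 (hcoMulti W hmono)

/-- **Lane B's registered open stub SHRINKS to the multi-carrier corner curves: `Theorems.CornerAtThreeCoStepL`
(p530129; the ONE open stub `stub_upper3_coStepL` of `Lines/cochainUpper.lean`) ⟸ { J₃-MAX on MONO-carrier corner
curves, `Three.CornerCoStepLAt` on MULTI-carrier corner curves } + cited facts** (as in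
`cornerAtThreeUpper_of_jetchevMaxMono_of_coStepLMulti_of_facts`, plus Gross–Zagier ∕ Kolyvagin ∕ modularity ∕
Matar–Nekovář for g0's converse). CONDITIONAL on the two hypothesis-shaped inputs and the cited facts; closes nothing.
[cite: Jetchev2008, Thm. 1.4 (shape)] [cite: MatarNekovar2019, Thm. 0.3 (p. 456)]
[cite: Castella2018, §5 (5.1)–(5.2) (arXiv:1704.06608 p. 12)] -/
theorem cornerAtThreeCoStepL_of_jetchevMaxMono_of_coStepLMulti_of_facts [Fact (Nat.Prime 3)]
    (hGZ : ∀ (N : ℕ) [NeZero N] (W : WeierstrassCurve ℚ) (K : Type) [Field K] [NumberField K],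
      gross_zagier N W K)
    (hKo : ∀ (N : ℕ) [NeZero N] (W : WeierstrassCurve ℚ) (K : Type) [Field K] [NumberField K],
      kolyvagin N W K)
    (hmod : hasEntireLFunction_rat)
    (hGZK : rank_eq_analyticRank_of_analyticRank_le_one) (hnf : exists_isNewformOf)
    (hPT : ∀ (K : Type) [Field K] [NumberField K], poitouTate_selmerStructure_duality K)
    (hPT2 : ∀ (K : Type) [Field K] [NumberField K], poitouTate_sha_tateDual K)
    (hMN : ∀ (N : ℕ) [NeZero N] (W : WeierstrassCurve ℚ) (K : Type) [Field K] [NumberField K],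
      MatarNekovar2019.thm03_padicValNat_card_sha_le_of_irreducible N W K)
    (hrec : ∀ (N : ℕ) [NeZero N] (W : WeierstrassCurve ℚ) (K : Type) [Field K] [NumberField K],
      heegnerPointOfConductor_one_galoisConj N W K)
    (hD36 : ∀ (N : ℕ) [NeZero N] (W : WeierstrassCurve ℚ) (K : Type) [Field K] [NumberField K],
      phi_heegnerTau_mem_singularModuliField N W K)
    (hChaU : Cha2005.rmk25_padicValNat_card_sha_primary_add_le_of_globalDivisibility)
    (hmaxMono : ∀ (W : WeierstrassCurve ℚ) [W.IsElliptic] [W.IsGloballyMinimal] [NeZero (W.conductorNorm ℤ)]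
      (K : Type) [Field K] [NumberField K]
      (Dt : ModularParametrizationData W (W.conductorNorm ℤ)) (β : ℤ) (ι : K →+* ℂ),
      (∃ v : HeightOneSpectrum (𝓞 ℚ),
        padicValNat 3 W.tamagawaProduct ≤ padicValNat 3 (W.tamagawaNumberAt v)) →
      ClassX11b W 3 → ¬ Surj W 3 →
      IsImaginaryQuadratic K → SatisfiesHeegnerHypothesis (W.conductorNorm ℤ) K →
      Odd (NumberField.discr K) →
      (4 * (W.conductorNorm ℤ : ℤ)) ∣ β ^ 2 - NumberField.discr K → ¬ (3 : ℤ) ∣ Dt.c →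
      ∀ (v : HeightOneSpectrum (𝓞 ℚ)) (s : ℕ), s ≤ padicValNat 3 (W.tamagawaNumberAt v) →
        ∀ (n : ℕ) (d : KolyvaginHeegnerData Dt β ι n), Squarefree n →
          (∀ ℓ ∈ n.primeFactors, Zhang2014.IsKolyvaginPrime (W.conductorNorm ℤ) W K 3 ℓ ∧
            s ≤ Zhang2014.kolyvaginIndex W 3 ℓ) → Koly.PDiv d 3 s)
    (hcoMulti : ∀ (W : WeierstrassCurve ℚ) [W.IsElliptic] [W.IsGloballyMinimal],
      (∀ v : HeightOneSpectrum (𝓞 ℚ),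
        padicValNat 3 (W.tamagawaNumberAt v) < padicValNat 3 W.tamagawaProduct) →
      CornerCoStepLAt W) :
    Summit.BirchSwinnertonDyer.BirchSwinnertonDyer.Theorems.CornerAtThreeCoStepL := by
  intro W _ _
  by_cases hmono : ∃ v : HeightOneSpectrum (𝓞 ℚ),
      padicValNat 3 W.tamagawaProduct ≤ padicValNat 3 (W.tamagawaNumberAt v)
  · exact cornerCoStepLAt_of_jetchevMaxAt_of_monoCarrier_of_facts hGZ hKo hmod hGZK hnf hPT hPT2 hMN hrec hD36
      hChaU W hmono
      (fun K _ _ Dt β ι hX hns hK hHN hodd hβ hc v s hs n d hn hℓ ↦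
        hmaxMono W K Dt β ι hmono hX hns hK hHN hodd hβ hc v s hs n d hn hℓ)
  · push Not at hmono
    exact hcoMulti W hmono

end Summit.BirchSwinnertonDyer.Rank1Residual.X11b.Three

end
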